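import Summits.QuantumFields.GaugeBoot.OneLinkShiftCalculus
import Mathlib.Topology.ContinuousMap.StoneWeierstrass
import HarnessLib

/-!
# Polynomial observables of lattice gauge configurations: density, shift invariance, flow derivatives (gauge-boot, L1 supplement)

HONEST FRAMING (cell `pub-gaugeboot`, page 1 of every file): the venture produces certified bounds
on lattice expectations at stated coupling, gauge group, dimension and torus size; NOT a mass gap,
NOT a continuum limit, NOT a string tension; NOT Yang–Mills-summit-bearing (barriers
`FixedCouplingUltralocality`, `PerturbativeInvisibility`). Structural; it certifies no number.

## Content

The test functions of a lattice bootstrap are POLYNOMIALS in the matrix entries of the link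
variables (Wilson loops, open strings). For a faithful continuous unitary representation
`r : LatticeRep G` and configurations `ι → G` this file sets up

* `reEntry` / `imEntry` — `U ↦ Re ρ(U_e)_{ab}`, `Im ρ(U_e)_{ab}` as continuous functions;
  `polyAlgebra (ι := ι) r` — the unital `ℝ`-subalgebra of `C(ι → G, ℝ)` they generate, and its image
  `polyFunctions (ι := ι) r` in the algebra of all real functions (membership without bundled continuity);
* ★ `polyAlgebra_topologicalClosure` — it is DENSE in `C(ι → G, ℝ)` (`G` compact): it separates
  points because `ρ` is faithful (`polyAlgebra_separatesPoints`); Stone–Weierstrass (Mathlib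
  `ContinuousMap.subalgebra_topologicalClosure_eq_top_of_separatesPoints`);
* `comp_updateMul_mem_polyAlgebra` — invariance under every one-link left shift `U ↦ U[e ↦ g U_e]`
  (`Re (ρ(g)ρ(U_e))_{ab}` is a linear combination of generators);
* `exists_hasDerivAt_of_mem_polyAlgebra` — every polynomial observable is differentiable along
  every exponential one-link shift (`ρ(k t) = e^{tX}`), with a continuous derivative
  (`Algebra.adjoin_induction`, product rule);
* `EntriesPoly` bookkeeping (products, unitary inverses, traces, four-letter words) — used by
  `PolynomialSchwingerDyson.lean` to show that the Wilson actions are polynomial observables and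
  that the Schwinger–Dyson identities on polynomial test functions alone already determine the
  Wilson measure in finite volume.

References: M. H. Stone (1948) / Mathlib Stone–Weierstrass; V. Kazakov, Z. Zheng, arXiv:2203.11360
§2 (Wilson loops as the bootstrap's variables). Folklore.
-/

noncomputable section

open MeasureTheory Filter Topology NormedSpace
open scoped Matrix.Norms.Frobenius Matrix
open Literature.MathematicalPhysics.QuantumFieldTheory (LatticeRep)

namespace Summit.QuantumFields.GaugeBoot

variable {ι : Type*} {G : Type*} [Group G] [TopologicalSpace G] (r : LatticeRep G)

/-! ## The coordinate algebra -/

/-- The real part of the `(a, b)` entry of the link variable `U_e` in the representation `r.ρ`, as a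
continuous function of the configuration. [folklore] -/
def reEntry (e : ι) (a b : Fin r.N) : C(ι → G, ℝ) where
  toFun U := (r.ρ (U e) a b).re
  continuous_toFun :=
    Complex.continuous_re.comp ((r.continuous.comp (continuous_apply e)).matrix_elem a b)

/-- The imaginary part of the `(a, b)` entry of the link variable `U_e`. [folklore] -/
def imEntry (e : ι) (a b : Fin r.N) : C(ι → G, ℝ) where
  toFun U := (r.ρ (U e) a b).im
  continuous_toFun :=
    Complex.continuous_im.comp ((r.continuous.comp (continuous_apply e)).matrix_elem a b)

/-- `reEntry` evaluated. -/
@[simp] theorem reEntry_apply (e : ι) (a b : Fin r.N) (U : ι → G) :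
    reEntry r e a b U = (r.ρ (U e) a b).re := rfl

/-- `imEntry` evaluated. -/
@[simp] theorem imEntry_apply (e : ι) (a b : Fin r.N) (U : ι → G) :
    imEntry r e a b U = (r.ρ (U e) a b).im := rfl

/-- The generators: real and imaginary parts of all matrix entries of all links. [folklore] -/
def entryGens : Set C(ι → G, ℝ) :=
  Set.range (fun p : ι × Fin r.N × Fin r.N => reEntry r p.1 p.2.1 p.2.2) ∪
    Set.range (fun p : ι × Fin r.N × Fin r.N => imEntry r p.1 p.2.1 p.2.2)

/-- **The algebra of polynomial observables**: the unital `ℝ`-subalgebra of `C(ι → G, ℝ)` generated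
by the real and imaginary parts of the matrix entries of the link variables (it contains every
Wilson loop and every open string). [folklore] -/
def polyAlgebra : Subalgebra ℝ C(ι → G, ℝ) := Algebra.adjoin ℝ (entryGens (ι := ι) r)

/-- The polynomial observables as plain functions (image of `polyAlgebra` under the coercion).
[folklore] -/
def polyFunctions : Subalgebra ℝ ((ι → G) → ℝ) :=
  (polyAlgebra (ι := ι) r).map (ContinuousMap.coeFnAlgHom ℝ)

/-- Generators are polynomial observables. -/
theorem reEntry_mem (e : ι) (a b : Fin r.N) : reEntry r e a b ∈ polyAlgebra (ι := ι) r :=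
  Algebra.subset_adjoin (Or.inl ⟨(e, a, b), rfl⟩)

/-- Generators are polynomial observables. -/
theorem imEntry_mem (e : ι) (a b : Fin r.N) : imEntry r e a b ∈ polyAlgebra (ι := ι) r :=
  Algebra.subset_adjoin (Or.inr ⟨(e, a, b), rfl⟩)

/-- Membership in `polyFunctions`. -/
theorem mem_polyFunctions_iff {f : (ι → G) → ℝ} :
    f ∈ polyFunctions (ι := ι) r ↔ ∃ g ∈ polyAlgebra (ι := ι) r, ⇑g = f := Subalgebra.mem_map

/-- The underlying function of a polynomial observable. -/
theorem coe_mem_polyFunctions {g : C(ι → G, ℝ)} (hg : g ∈ polyAlgebra (ι := ι) r) : ⇑g ∈ polyFunctions (ι := ι) r :=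
  (mem_polyFunctions_iff r).2 ⟨g, hg, rfl⟩

/-- Polynomial observables are continuous. -/
theorem continuous_of_mem_polyFunctions {f : (ι → G) → ℝ} (hf : f ∈ polyFunctions (ι := ι) r) :
    Continuous f := by
  obtain ⟨g, -, rfl⟩ := (mem_polyFunctions_iff r).1 hf
  exact g.continuous

/-- `U ↦ Re ρ(U_e)_{ab}` is a polynomial observable. -/
theorem re_entry_mem_polyFunctions (e : ι) (a b : Fin r.N) :
    (fun U : ι → G => (r.ρ (U e) a b).re) ∈ polyFunctions (ι := ι) r :=
  coe_mem_polyFunctions r (reEntry_mem r e a b)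

/-- `U ↦ Im ρ(U_e)_{ab}` is a polynomial observable. -/
theorem im_entry_mem_polyFunctions (e : ι) (a b : Fin r.N) :
    (fun U : ι → G => (r.ρ (U e) a b).im) ∈ polyFunctions (ι := ι) r :=
  coe_mem_polyFunctions r (imEntry_mem r e a b)

/-! ## Density (Stone–Weierstrass) -/

/-- **The polynomial observables separate the configurations** (`ρ` is faithful). [folklore] -/
theorem polyAlgebra_separatesPoints : (polyAlgebra (ι := ι) r).SeparatesPoints := by
  intro U V hUV
  obtain ⟨e, he⟩ : ∃ e, U e ≠ V e := Function.ne_iff.1 hUV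
  have hρ : r.ρ (U e) ≠ r.ρ (V e) := fun h => he (r.injective h)
  obtain ⟨a, b, hab⟩ : ∃ a b, r.ρ (U e) a b ≠ r.ρ (V e) a b := by
    by_contra h
    simp only [not_exists, not_not] at h
    exact hρ (Matrix.ext fun a b => h a b)
  by_cases hre : (r.ρ (U e) a b).re = (r.ρ (V e) a b).re
  · have him : (r.ρ (U e) a b).im ≠ (r.ρ (V e) a b).im := fun h => hab (Complex.ext hre h)
    exact ⟨imEntry r e a b, ⟨imEntry r e a b, imEntry_mem r e a b, rfl⟩, him⟩
  · exact ⟨reEntry r e a b, ⟨reEntry r e a b, reEntry_mem r e a b, rfl⟩, hre⟩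

variable [CompactSpace G]

/-- ★ **The polynomial observables are dense** in `C(ι → G, ℝ)` (Stone–Weierstrass). [folklore] -/
theorem polyAlgebra_topologicalClosure : (polyAlgebra (ι := ι) r).topologicalClosure = ⊤ :=
  ContinuousMap.subalgebra_topologicalClosure_eq_top_of_separatesPoints _
    (polyAlgebra_separatesPoints r)

/-- Every continuous observable is a uniform limit of polynomial observables. [folklore] -/
theorem mem_closure_polyAlgebra (f : C(ι → G, ℝ)) : f ∈ closure (polyAlgebra (ι := ι) r : Set C(ι → G, ℝ)) := by
  have h := congrArg (fun s : Subalgebra ℝ C(ι → G, ℝ) => (s : Set C(ι → G, ℝ)))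
    (polyAlgebra_topologicalClosure (ι := ι) r)
  simp only [Subalgebra.topologicalClosure_coe, Algebra.coe_top] at h
  rw [h]
  exact Set.mem_univ f

omit [CompactSpace G]

/-! ## Invariance under one-link shifts -/

section Shift

variable [DecidableEq ι] [ContinuousMul G]

/-- The one-link left shift `U ↦ U[e ↦ g U_e]` as a continuous self-map. [folklore] -/
def shiftCM (e : ι) (g : G) : C(ι → G, ι → G) where
  toFun U := Function.update U e (g * U e)
  continuous_toFun := continuous_id.update e (continuous_const.mul (continuous_apply e))

/-- `shiftCM` evaluated. -/
@[simp] theorem shiftCM_apply (e : ι) (g : G) (U : ι → G) :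
    shiftCM e g U = Function.update U e (g * U e) := rfl

/-- `Re (ρ(g)ρ(U_e))_{ab} = Σ_c (Re ρ(g)_{ac} Re ρ(U_e)_{cb} - Im ρ(g)_{ac} Im ρ(U_e)_{cb})`: the shifted
generator is a linear combination of generators. [folklore] -/
theorem reEntry_comp_shiftCM (e : ι) (a b : Fin r.N) (g : G) :
    (reEntry r e a b).comp (shiftCM e g) =
      ∑ c, ((r.ρ g a c).re • reEntry r e c b - (r.ρ g a c).im • imEntry r e c b) := by
  ext U
  simp [Matrix.mul_apply, Complex.re_sum, Complex.mul_re, ContinuousMap.coe_sum, Finset.sum_apply]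

/-- `Im (ρ(g)ρ(U_e))_{ab} = Σ_c (Re ρ(g)_{ac} Im ρ(U_e)_{cb} + Im ρ(g)_{ac} Re ρ(U_e)_{cb})`. [folklore] -/
theorem imEntry_comp_shiftCM (e : ι) (a b : Fin r.N) (g : G) :
    (imEntry r e a b).comp (shiftCM e g) =
      ∑ c, ((r.ρ g a c).re • imEntry r e c b + (r.ρ g a c).im • reEntry r e c b) := by
  ext U
  simp [Matrix.mul_apply, Complex.im_sum, Complex.mul_im, ContinuousMap.coe_sum, Finset.sum_apply]

/-- **The polynomial observables are invariant under every one-link left shift.** [folklore] -/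
theorem comp_shiftCM_mem_polyAlgebra (e : ι) (g : G) {f : C(ι → G, ℝ)} (hf : f ∈ polyAlgebra (ι := ι) r) :
    f.comp (shiftCM e g) ∈ polyAlgebra (ι := ι) r := by
  have h : polyAlgebra (ι := ι) r ≤ (polyAlgebra (ι := ι) r).comap
      (ContinuousMap.compRightAlgHom ℝ ℝ (shiftCM (ι := ι) e g)) := by
    refine Algebra.adjoin_le ?_
    rintro _ (⟨⟨e', a, b⟩, rfl⟩ | ⟨⟨e', a, b⟩, rfl⟩)
    · change (reEntry r e' a b).comp (shiftCM e g) ∈ polyAlgebra (ι := ι) r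
      by_cases he : e' = e
      · subst he
        rw [reEntry_comp_shiftCM]
        exact Subalgebra.sum_mem _ fun c _ => Subalgebra.sub_mem _
          (Subalgebra.smul_mem _ (reEntry_mem r _ c b) _) (Subalgebra.smul_mem _ (imEntry_mem r _ c b) _)
      · have : (reEntry r e' a b).comp (shiftCM e g) = reEntry r e' a b := by
          ext U; simp [Function.update_of_ne he]
        rw [this]
        exact reEntry_mem r e' a b
    · change (imEntry r e' a b).comp (shiftCM e g) ∈ polyAlgebra (ι := ι) r
      by_cases he : e' = e
      · subst he
        rw [imEntry_comp_shiftCM]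
        exact Subalgebra.sum_mem _ fun c _ => Subalgebra.add_mem _
          (Subalgebra.smul_mem _ (imEntry_mem r _ c b) _) (Subalgebra.smul_mem _ (reEntry_mem r _ c b) _)
      · have : (imEntry r e' a b).comp (shiftCM e g) = imEntry r e' a b := by
          ext U; simp [Function.update_of_ne he]
        rw [this]
        exact imEntry_mem r e' a b
  exact h hf

/-- Function form of the shift invariance. -/
theorem comp_updateMul_mem_polyFunctions (e : ι) (g : G) {f : (ι → G) → ℝ}
    (hf : f ∈ polyFunctions (ι := ι) r) :
    (fun U => f (Function.update U e (g * U e))) ∈ polyFunctions (ι := ι) r := by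
  obtain ⟨f₀, hf₀, rfl⟩ := (mem_polyFunctions_iff r).1 hf
  exact (mem_polyFunctions_iff r).2 ⟨f₀.comp (shiftCM e g), comp_shiftCM_mem_polyAlgebra r e g hf₀, rfl⟩

end Shift

/-! ## Differentiability along exponential one-link shifts -/

section Deriv

variable [DecidableEq ι]

/-- The real part of a matrix entry of a differentiable matrix family is differentiable. [folklore] -/
theorem hasDerivAt_entry_re {n : ℕ} {M : ℝ → Matrix (Fin n) (Fin n) ℂ} {M' : Matrix (Fin n) (Fin n) ℂ}
    {t : ℝ} (hM : HasDerivAt M M' t) (a b : Fin n) :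
    HasDerivAt (fun s => (M s a b).re) (M' a b).re t := by
  let L : Matrix (Fin n) (Fin n) ℂ →L[ℝ] ℝ := LinearMap.toContinuousLinearMap
    (Complex.reLm.comp ((Matrix.entryLinearMap ℂ ℂ a b).restrictScalars ℝ))
  exact L.hasFDerivAt.comp_hasDerivAt t hM

/-- The imaginary part of a matrix entry of a differentiable matrix family is differentiable.
[folklore] -/
theorem hasDerivAt_entry_im {n : ℕ} {M : ℝ → Matrix (Fin n) (Fin n) ℂ} {M' : Matrix (Fin n) (Fin n) ℂ}
    {t : ℝ} (hM : HasDerivAt M M' t) (a b : Fin n) :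
    HasDerivAt (fun s => (M s a b).im) (M' a b).im t := by
  let L : Matrix (Fin n) (Fin n) ℂ →L[ℝ] ℝ := LinearMap.toContinuousLinearMap
    (Complex.imLm.comp ((Matrix.entryLinearMap ℂ ℂ a b).restrictScalars ℝ))
  exact L.hasFDerivAt.comp_hasDerivAt t hM

/-- ★ **Every polynomial observable is differentiable along every exponential one-link shift**
`U ↦ U[e ↦ k(t) U_e]`, `ρ(k t) = e^{tX}`, with a continuous derivative (induction over the
algebra: generators by `hasDerivAt_rho_update`, product rule). [folklore] -/
theorem exists_hasDerivAt_of_mem_polyAlgebra {k : ℝ → G} (hk : ∀ s t, k (s + t) = k s * k t)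
    {X : Matrix (Fin r.N) (Fin r.N) ℂ} (hX : ∀ t, r.ρ (k t) = exp ((t : ℂ) • X)) (e : ι)
    {f : C(ι → G, ℝ)} (hf : f ∈ polyAlgebra (ι := ι) r) :
    ∃ f' : (ι → G) → ℝ, Continuous f' ∧
      ∀ U, HasDerivAt (fun t => f (Function.update U e (k t * U e))) (f' U) 0 := by
  have h0 : k 0 = 1 := by
    have h := hk 0 0
    rw [add_zero] at h
    exact mul_eq_left.1 h.symm
  have hU0 : ∀ U : ι → G, Function.update U e (k 0 * U e) = U := fun U => by
    rw [h0, one_mul, Function.update_eq_self]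
  have hgen : ∀ e' : ι, Continuous fun U : ι → G =>
      (if e' = e then X * r.ρ (U e) else 0 : Matrix (Fin r.N) (Fin r.N) ℂ) := fun e' => by
    split_ifs
    · exact continuous_const.mul (r.continuous.comp (continuous_apply e))
    · exact continuous_const
  induction hf using Algebra.adjoin_induction with
  | mem f hf =>
    rcases hf with ⟨⟨e', a, b⟩, rfl⟩ | ⟨⟨e', a, b⟩, rfl⟩
    · exact ⟨fun U => ((if e' = e then X * r.ρ (U e) else 0 : Matrix (Fin r.N) (Fin r.N) ℂ) a b).re,
        Complex.continuous_re.comp ((hgen e').matrix_elem a b),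
        fun U => hasDerivAt_entry_re (hasDerivAt_rho_update r.ρ hX e e' U) a b⟩
    · exact ⟨fun U => ((if e' = e then X * r.ρ (U e) else 0 : Matrix (Fin r.N) (Fin r.N) ℂ) a b).im,
        Complex.continuous_im.comp ((hgen e').matrix_elem a b),
        fun U => hasDerivAt_entry_im (hasDerivAt_rho_update r.ρ hX e e' U) a b⟩
  | algebraMap c =>
    refine ⟨fun _ => 0, continuous_const, fun U => ?_⟩
    simp only [Algebra.algebraMap_eq_smul_one, ContinuousMap.smul_apply, ContinuousMap.one_apply]
    exact hasDerivAt_const _ _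
  | add f g _ _ ihf ihg =>
    obtain ⟨f', hf'c, hf'⟩ := ihf
    obtain ⟨g', hg'c, hg'⟩ := ihg
    refine ⟨fun U => f' U + g' U, hf'c.add hg'c, fun U => ?_⟩
    have h : HasDerivAt (fun t => f (Function.update U e (k t * U e)) +
        g (Function.update U e (k t * U e))) (f' U + g' U) 0 := (hf' U).add (hg' U)
    simpa only [ContinuousMap.add_apply] using h
  | mul f g _ _ ihf ihg =>
    obtain ⟨f', hf'c, hf'⟩ := ihf
    obtain ⟨g', hg'c, hg'⟩ := ihg
    refine ⟨fun U => f' U * g U + f U * g' U,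
      (hf'c.mul g.continuous).add (f.continuous.mul hg'c), fun U => ?_⟩
    have h : HasDerivAt (fun t => f (Function.update U e (k t * U e)) *
        g (Function.update U e (k t * U e)))
        (f' U * g (Function.update U e (k 0 * U e)) + f (Function.update U e (k 0 * U e)) * g' U) 0 :=
      (hf' U).mul (hg' U)
    simp only [hU0] at h
    simpa only [ContinuousMap.mul_apply] using h

/-- Function form: every element of `polyFunctions` is differentiable along every exponential
one-link shift, with a continuous derivative. [folklore] -/
theorem exists_hasDerivAt_of_mem_polyFunctions {k : ℝ → G} (hk : ∀ s t, k (s + t) = k s * k t)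
    {X : Matrix (Fin r.N) (Fin r.N) ℂ} (hX : ∀ t, r.ρ (k t) = exp ((t : ℂ) • X)) (e : ι)
    {f : (ι → G) → ℝ} (hf : f ∈ polyFunctions (ι := ι) r) :
    ∃ f' : (ι → G) → ℝ, Continuous f' ∧
      ∀ U, HasDerivAt (fun t => f (Function.update U e (k t * U e))) (f' U) 0 := by
  obtain ⟨g, hg, rfl⟩ := (mem_polyFunctions_iff r).1 hf
  exact exists_hasDerivAt_of_mem_polyAlgebra r hk hX e hg

end Deriv

/-! ## Matrix-valued polynomial observables: products, unitary inverses, traces -/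

/-- A matrix-valued function of the configuration all of whose entries have polynomial real and
imaginary parts. [shape] A parametric definition of a proposition — NOT a fact. [folklore] -/
def EntriesPoly (M : (ι → G) → Matrix (Fin r.N) (Fin r.N) ℂ) : Prop :=
  ∀ a b, (fun U => (M U a b).re) ∈ polyFunctions (ι := ι) r ∧ (fun U => (M U a b).im) ∈ polyFunctions (ι := ι) r

/-- The link variables themselves. -/
theorem entriesPoly_rho (e : ι) : EntriesPoly r (fun U : ι → G => r.ρ (U e)) := fun a b =>
  ⟨re_entry_mem_polyFunctions r e a b, im_entry_mem_polyFunctions r e a b⟩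

/-- Products. -/
theorem EntriesPoly.mul {M P : (ι → G) → Matrix (Fin r.N) (Fin r.N) ℂ} (hM : EntriesPoly r M)
    (hP : EntriesPoly r P) : EntriesPoly r (fun U => M U * P U) := by
  intro a b
  have hre : (fun U => ((M U * P U) a b).re) =
      ∑ c, ((fun U => (M U a c).re) * (fun U => (P U c b).re) -
        (fun U => (M U a c).im) * (fun U => (P U c b).im)) := by
    funext U
    simp [Matrix.mul_apply, Complex.re_sum, Complex.mul_re, Finset.sum_apply]
  have him : (fun U => ((M U * P U) a b).im) =
      ∑ c, ((fun U => (M U a c).re) * (fun U => (P U c b).im) +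
        (fun U => (M U a c).im) * (fun U => (P U c b).re)) := by
    funext U
    simp [Matrix.mul_apply, Complex.im_sum, Complex.mul_im, Finset.sum_apply]
  refine ⟨?_, ?_⟩
  · rw [hre]
    exact Subalgebra.sum_mem _ fun c _ => Subalgebra.sub_mem _
      (Subalgebra.mul_mem _ (hM a c).1 (hP c b).1) (Subalgebra.mul_mem _ (hM a c).2 (hP c b).2)
  · rw [him]
    exact Subalgebra.sum_mem _ fun c _ => Subalgebra.add_mem _
      (Subalgebra.mul_mem _ (hM a c).1 (hP c b).2) (Subalgebra.mul_mem _ (hM a c).2 (hP c b).1)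

/-- Inverse link variables (entries of `ρ(U_e)ᴴ` are conjugates of entries of `ρ(U_e)`). -/
theorem entriesPoly_rho_inv (e : ι) : EntriesPoly r (fun U : ι → G => r.ρ ((U e)⁻¹)) := by
  intro a b
  -- `ρ(g⁻¹) = ρ(g)ᴴ` for the unitary representation `r.ρ` (as in the tree's `onelink_rho_inv`)
  have rho_inv_eq_conjTranspose : ∀ g : G, r.ρ g⁻¹ = (r.ρ g)ᴴ := fun g => by
    have h1 : r.ρ g⁻¹ * r.ρ g = 1 := by rw [← map_mul, inv_mul_cancel, map_one]
    have h2 : (r.ρ g)ᴴ * r.ρ g = 1 := by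
      have := Matrix.mem_unitaryGroup_iff'.1 (r.mem_unitary g)
      rwa [Matrix.star_eq_conjTranspose] at this
    rw [← Matrix.inv_eq_left_inv h1, Matrix.inv_eq_left_inv h2]
  have h1 : (fun U : ι → G => (r.ρ ((U e)⁻¹) a b).re) = fun U => (r.ρ (U e) b a).re := by
    funext U
    rw [rho_inv_eq_conjTranspose, Matrix.conjTranspose_apply, Complex.star_def, Complex.conj_re]
  have h2 : (fun U : ι → G => (r.ρ ((U e)⁻¹) a b).im) = -fun U => (r.ρ (U e) b a).im := by
    funext U
    rw [Pi.neg_apply, rho_inv_eq_conjTranspose, Matrix.conjTranspose_apply, Complex.star_def,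
      Complex.conj_im]
  change (fun U : ι → G => (r.ρ ((U e)⁻¹) a b).re) ∈ polyFunctions (ι := ι) r ∧
    (fun U : ι → G => (r.ρ ((U e)⁻¹) a b).im) ∈ polyFunctions (ι := ι) r
  rw [h1, h2]
  exact ⟨re_entry_mem_polyFunctions r e b a, Subalgebra.neg_mem _ (im_entry_mem_polyFunctions r e b a)⟩

/-- The real part of the trace of a matrix-valued polynomial observable is polynomial. -/
theorem EntriesPoly.trace_re {M : (ι → G) → Matrix (Fin r.N) (Fin r.N) ℂ} (hM : EntriesPoly r M) :
    (fun U => (M U).trace.re) ∈ polyFunctions (ι := ι) r := by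
  have h : (fun U => (M U).trace.re) = ∑ a, fun U => (M U a a).re := by
    funext U
    simp [Matrix.trace, Complex.re_sum, Finset.sum_apply]
  rw [h]
  exact Subalgebra.sum_mem _ fun a _ => (hM a a).1

/-- `N - Re tr` of a matrix-valued polynomial observable is polynomial. -/
theorem EntriesPoly.const_sub_trace_re {M : (ι → G) → Matrix (Fin r.N) (Fin r.N) ℂ}
    (hM : EntriesPoly r M) (c : ℝ) : (fun U => c - (M U).trace.re) ∈ polyFunctions (ι := ι) r := by
  have h : (fun U => c - (M U).trace.re) = algebraMap ℝ ((ι → G) → ℝ) c - fun U => (M U).trace.re := by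
    funext U
    simp [Pi.algebraMap_apply]
  rw [h]
  exact Subalgebra.sub_mem _ (Subalgebra.algebraMap_mem _ c) hM.trace_re

/-- **A four-letter word `Re tr ρ(U_a U_b U_c⁻¹ U_d⁻¹)` subtracted from a constant is a polynomial
observable.** [folklore] -/
theorem const_sub_reTrace_word₄_mem_polyFunctions (a b c d : ι) (C : ℝ) :
    (fun U : ι → G => C - (r.ρ (U a * U b * (U c)⁻¹ * (U d)⁻¹)).trace.re) ∈ polyFunctions (ι := ι) r := by
  have h : EntriesPoly r (fun U : ι → G => r.ρ (U a * U b * (U c)⁻¹ * (U d)⁻¹)) := by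
    have := (((entriesPoly_rho r a).mul r (entriesPoly_rho r b)).mul r (entriesPoly_rho_inv r c)).mul r
      (entriesPoly_rho_inv r d)
    simpa only [map_mul] using this
  exact h.const_sub_trace_re r C

end Summit.QuantumFields.GaugeBoot

end
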